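import Summits.BirchSwinnertonDyer.BirchSwinnertonDyer.Theorems.SignedLowerHalvesSmallImageLowerHalfBothSignsRttRecipMTOfValues
import Literature.NumberTheory.EllipticCurves.MazurTateElementCoeffField
import HarnessLib

/-!
# Route `SignedLowerHalves`, crux L `SmallImageLowerHalfBothSigns` (stmt-BirchSwinnertonDyer-23599), line `rtt_w3` v37 — row S4″ (`stub_junctionRecipMT_ns`), brick β7 (ASSEMBLY),
# LEAD g15, part 3: THE PASTE-READY FORM — Mazur–Tate elements at a cohomological period, content constant, packaged `∃ c d`

Specialisation of part 2 (★★★ `isCongrModOmegaO_of_primitive_values`) to the objects of the S4″ prefix: `T = range ι`, `θ_n = θ_n(g;Ω)^ι` for a newform `g` with a COHOMOLOGICAL plus period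
(Pollack–Weston Def. 2.1 ⇒ `θ_n(g;Ω)^ι ∈ 𝒪[T]`, Rem. 2.2 — `exists_padicCoeffIntegers_map_eq_mazurTateElementK`, the integral lift the identity principle wants), the readout for an element
`C a · Y₀` carrying -w3 g29's content constant `a ∈ 𝒪_S ∖ 0` (RULING «S₁ = B»), and the conclusion PACKAGED as `∃ c' d' ≠ 0, ∀ n of parity ε, d'·θ_n ≡ (−1)^{n/2+1}ω_n^∓·(c'·ι_S(U⁻¹·Y₀)) (mod ω_n)`
— literally the matrix of the registered `CharRoadRecipMT` once `Y₀ := Col₀(jv(s ζ̄_𝔞))` and `Col := U⁻¹ • Col₀`: ★★★ `exists_isCongrModOmegaO_mazurTateElementK_of_primitive_values`.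
THEOREMS ONLY (`--supports stmt-BirchSwinnertonDyer-23599` helper); closes nothing; S4″, crux L and BSD remain OPEN, proved for NO curve.
References: [PollackWeston2011MT] Def. 2.1, Rem. 2.2; [Kobayashi2003] Thm. 6.3; [Pollack2003] §6.5 Prop. 6.18.
-/

set_option autoImplicit false
-- the Theorems namespace of this sub repeats the summit name by design (D-0017 nested layout)
set_option linter.dupNamespace false

noncomputable section

open scoped MatrixGroups ModularForm
open Polynomial CongruenceSubgroup
open Literature.NumberTheory.EllipticCurves Literature.NumberTheory.EllipticCurves.ModularForms
open Summit.BirchSwinnertonDyer.BirchSwinnertonDyer.Theorems.ThetaTransport.MazurTateValuesRelay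

namespace Summit.BirchSwinnertonDyer.BirchSwinnertonDyer.Theorems.SmallImageRttReciprocity

variable {p : ℕ} [hp : Fact p.Prime] {M : ℕ} {g : CuspForm (Gamma0 M) 2} {ι : coeffField g →+* PadicAlgCl p} {Ω : ℂ}

/-- **At a cohomological period `θ_n(g;Ω)^ι` lifts to `𝒪[T]`, `𝒪 = padicCoeffIntegers (range ι)`** (Pollack–Weston Rem. 2.2: integral coefficients, each in `ι(K_g) ⊆ ℚ_p(ι K_g)`).
The `padicCoeffIntegers` twin of `ResidualThetaLayer.exists_map_eq_map_mazurTateElementK` (stated there for the unit ball). [cite: PollackWeston2011MT, Rem. 2.2] -/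
theorem exists_padicCoeffIntegers_map_eq_mazurTateElementK (hΩ : IsCohomologicalPlusPeriod g ι Ω) (n : ℕ) :
    ∃ Θ : (padicCoeffIntegers (Set.range ι))[X], Θ.map (padicCoeffIntegers (Set.range ι)).subtype = (mazurTateElementK g Ω p n).map ι := by
  have h : (mazurTateElementK g Ω p n).map ι ∈ Polynomial.lifts (padicCoeffIntegers (Set.range ι)).subtype := by
    rw [lifts_iff_coeff_lifts]
    intro j
    have hmem : ((mazurTateElementK g Ω p n).map ι).coeff j ∈ padicCoeffIntegers (Set.range ι) := by
      rw [mem_padicCoeffIntegers_iff]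
      refine ⟨?_, hΩ.norm_coeff_map_mazurTateElementK_le_one n j⟩
      rw [coeff_map]
      exact IntermediateField.subset_adjoin ℚ_[p] _ ⟨_, rfl⟩
    exact ⟨⟨_, hmem⟩, rfl⟩
  obtain ⟨Θ, hΘ⟩ := (mem_lifts _).mp h
  exact ⟨Θ, hΘ⟩

/-- ★★★ **S4″, PASTE-READY.** For a newform `g` with cohomological period `Ω` along `ι`, the prefix's `L` and `hcongr`, an element `Y₀ ∈ 𝒪_S⟦T⟧` (the β4 Coleman image `Col₀(jv(s ζ̄_𝔞))`)
with content constant `a ≠ 0` and readout `ω_n^∓·(C a·Y₀) ≡ Σ_{i<pⁿ} ev_{n,i}(1+T)^{pⁿ−i} (mod ω_n)` (-w3's `exists_colemanEquiv_cofree` shape), a unit `U` with representatives `u_n`, constants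
`c, d ≠ 0` and the VALUE IDENTITIES AT PRIMITIVE CHARACTERS `d·u_n(ζ−1)·θ_n(g;Ω)^ι(ζ−1) = (−1)^{n/2+1}·c·Σ ev_{n,i} ζ^{pⁿ−i}` (`n ≥ n₀` of parity `ε`): there are `c', d' ∈ 𝒪_{S ∪ range ι} ∖ 0` with
`d'·θ_n(g;Ω)^ι ≡ (−1)^{n/2+1}ω_n^∓·(c'·ι_S(U⁻¹·Y₀)) (mod ω_n)` for EVERY `n` of parity `ε` — the matrix of `CharRoadRecipMT` for `Col := U⁻¹•Col₀`. [cite: Kobayashi2003, Thm. 6.3]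
[cite: Pollack2003, §6.5 Prop. 6.18] [cite: PollackWeston2011MT, Rem. 2.2] -/
theorem exists_isCongrModOmegaO_mazurTateElementK_of_primitive_values (S : Set (PadicAlgCl p)) [FiniteDimensional ℚ_[p] (padicCoeffField (S ∪ Set.range ι))]
    (hΩ : IsCohomologicalPlusPeriod g ι Ω) (ε : ℤˣ) (L : IwasawaAlgebraO (Set.range ι))
    (hcongr : ∀ n : ℕ, (Even n ↔ ε = 1) → IsCongrModOmegaO (Set.range ι) n ((mazurTateElementK g Ω p n).map ι)
      (((((-1) ^ (n / 2 + 1) * (if ε = 1 then cyclotomicOmegaMinus p n else cyclotomicOmegaPlus p n)).map (Int.castRingHom (PadicAlgCl p)) :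
          (PadicAlgCl p)[X]) : PowerSeries (PadicAlgCl p)) * iwasawaOToPowerSeries (Set.range ι) L))
    (Y₀ : IwasawaAlgebraO S) (a : padicCoeffIntegers S) (ha : a ≠ 0) (ev : ℕ → ℕ → padicCoeffIntegers S)
    (hread : ∀ n : ℕ,
      (((if ε = 1 then cyclotomicOmegaMinus p n else cyclotomicOmegaPlus p n).map (Int.castRingHom (padicCoeffIntegers S)) :
          (padicCoeffIntegers S)[X]) : IwasawaAlgebraO S) * (PowerSeries.C a * Y₀) -
          ∑ i ∈ Finset.range (p ^ n), PowerSeries.C (ev n i) * (1 + PowerSeries.X : IwasawaAlgebraO S) ^ (p ^ n - i) ∈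
        Ideal.span {(1 + PowerSeries.X : IwasawaAlgebraO S) ^ p ^ n - 1})
    (U : (IwasawaAlgebraO S)ˣ) (u : ℕ → (padicCoeffIntegers S)[X])
    (hu : ∀ n : ℕ, (U : IwasawaAlgebraO S) - (u n : IwasawaAlgebraO S) ∈ Ideal.span {(1 + PowerSeries.X : IwasawaAlgebraO S) ^ p ^ n - 1})
    (c d : padicCoeffIntegers (S ∪ Set.range ι)) (hc : c ≠ 0) (hd : d ≠ 0) (n₀ : ℕ)
    (hval : ∀ n : ℕ, n₀ ≤ n → (Even n ↔ ε = 1) → ∀ ζ : PadicAlgCl p, IsPrimitiveRoot ζ (p ^ n) →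
      (d : PadicAlgCl p) * ((u n).map (padicCoeffIntegers S).subtype).eval (ζ - 1) * ((mazurTateElementK g Ω p n).map ι).eval (ζ - 1) =
        (-1) ^ (n / 2 + 1) * (c : PadicAlgCl p) * ∑ i ∈ Finset.range (p ^ n), (ev n i : PadicAlgCl p) * ζ ^ (p ^ n - i)) :
    ∃ (c' d' : padicCoeffIntegers (S ∪ Set.range ι)), c' ≠ 0 ∧ d' ≠ 0 ∧
      ∀ n : ℕ, (Even n ↔ ε = 1) → IsCongrModOmegaO (S ∪ Set.range ι) n (Polynomial.C ((d' : PadicAlgCl p)) * (mazurTateElementK g Ω p n).map ι)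
        (((((-1) ^ (n / 2 + 1) * (if ε = 1 then cyclotomicOmegaMinus p n else cyclotomicOmegaPlus p n)).map (Int.castRingHom (PadicAlgCl p)) : (PadicAlgCl p)[X]) :
            PowerSeries (PadicAlgCl p)) *
          (PowerSeries.C ((c' : PadicAlgCl p)) * iwasawaOToPowerSeries S (↑U⁻¹ * Y₀))) := by
  -- integral lifts of the Mazur–Tate elements
  choose Θ hΘ using exists_padicCoeffIntegers_map_eq_mazurTateElementK (p := p) hΩ
  -- the content constant moves into `c' := c · a`
  have hS : S ⊆ S ∪ Set.range ι := Set.subset_union_left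
  set a' : padicCoeffIntegers (S ∪ Set.range ι) := Subring.inclusion (padicCoeffIntegers_mono hS) a with ha'
  refine ⟨c * a', d, mul_ne_zero hc ?_, hd, fun n hn ↦ ?_⟩
  · intro h0
    apply ha
    have h1 : ((a' : padicCoeffIntegers (S ∪ Set.range ι)) : PadicAlgCl p) = 0 := by rw [h0, Subring.coe_zero]
    rw [ha', coe_inclO hS] at h1
    exact Subtype.ext (by simpa using h1)
  have key := isCongrModOmegaO_of_primitive_values S (Set.range ι) ε (fun n ↦ (mazurTateElementK g Ω p n).map ι) Θ hΘ L hcongr (PowerSeries.C a * Y₀) ev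
    (fun n _ ↦ hread n) U u (fun n _ ↦ hu n) c d ⟨n₀, hval⟩ n hn
  -- `ι_S(U⁻¹ · (C a · Y₀)) = C a · ι_S(U⁻¹ · Y₀)`
  have e : iwasawaOToPowerSeries S (↑U⁻¹ * (PowerSeries.C a * Y₀)) = PowerSeries.C (a : PadicAlgCl p) * iwasawaOToPowerSeries S (↑U⁻¹ * Y₀) := by
    rw [mul_left_comm, map_mul, iwasawaOToPowerSeries_C]
  rw [e, ← mul_assoc (PowerSeries.C (c : PadicAlgCl p)), ← map_mul] at key
  have hca : ((c * a' : padicCoeffIntegers (S ∪ Set.range ι)) : PadicAlgCl p) = (c : PadicAlgCl p) * (a : PadicAlgCl p) := by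
    rw [Subring.coe_mul, ha', coe_inclO hS]
  rw [hca]
  exact key

end Summit.BirchSwinnertonDyer.BirchSwinnertonDyer.Theorems.SmallImageRttReciprocity

end
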